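import Mathlib
import HarnessLib
import Literature.Analysis.FluidPDE.CurlIsometryCovariance
import Summits.NavierStokesRegularity.NavierStokesRegularity.Theorems.PoloidalWindowDoorPoloidalWindowRigidityRotate
import Summits.NavierStokesRegularity.NavierStokesRegularity.Theorems.HalfSpaceWindowDoorCirculationCarryingRigidityDefs

/-!
# Route `HalfSpaceWindowDoor`, crux `CirculationCarryingRigidity` (stmt-NavierStokesRegularity-25311) — PLUMBING stub
# `stub_rotate : RotationCovariance` of the skeleton of record (`CirculationCarryingRigidity_birth_v2_g3.lean`)

`RotationCovariance := HemisphereLiouvilleE3 → CirculationCarryingRigidity`: the `e₃`-Liouville statement for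
closed-hemisphere profiles gives the crux in EVERY direction `e ≠ 0`.  Proof: pick a linear isometry `L` of `ℝ³` with
`L⁻¹ e₃ = e/‖e‖` (`…PoloidalWindowRigidityRotate.exists_linearIsometryEquiv_symm_single_two`), and — composing with the
reflection in the plane `{x₀ = 0}` (which fixes `e₃` and has determinant `−1`, Mathlib `Submodule.det_reflection`) if
necessary — with `det L = 1`.  The conjugated profile `v'(t,x) = L v(t, L⁻¹x)` is again in the route's Type-I class
(`…PoloidalWindowRigidityRotate.class_conj_linearIsometryEquiv`), and by the pseudovector law of the curl
(`inner_curl_conj_linearIsometryEquiv`, `CurlIsometryCovariance`) `⟪curl v'(s)(y), e₃⟫ = ‖e‖⁻¹ ⟪curl v(s)(L⁻¹y), e⟫ ≥ 0`.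
The Liouville hypothesis forces `⟪curl v'(s), e₃⟫ ≡ 0`, contradicting the strict positivity of `⟪curl v(s₀)(y₀), e⟫`
at the witness point; so the crux's conclusion holds (vacuously — the backward-singularity hypothesis is not consumed:
this stub is the only consumer of the `∃`-strict-positivity clause).

Seat ns-hsw-p1 (LEAD of 25311, cell pub-ns-dss).  WHAT THIS IS NOT: not a statement about Navier–Stokes regularity;
plumbing for a STAGED door criterion about hypothetical blow-up profiles; lands `--supports` the crux item.
-/

noncomputable section

-- the summit and its single sub-problem share the name (CONVENTIONS §1), as in every Theorems file
set_option linter.dupNamespace false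

namespace Summit.NavierStokesRegularity.NavierStokesRegularity.Theorems.HalfSpaceWindowDoorCirculationCarryingRigidityRotate

open Set Function
open scoped RealInnerProductSpace InnerProductSpace
open Literature.Analysis Literature.Analysis.FluidPDE
open Summit.NavierStokesRegularity.NavierStokesRegularity.Theses.HalfSpaceWindowDoor
open Summit.NavierStokesRegularity.NavierStokesRegularity.Theorems.HalfSpaceWindowDoorCirculationCarryingRigidityDefs
open Summit.NavierStokesRegularity.NavierStokesRegularity.Theorems.PoloidalWindowDoorPoloidalWindowRigidityRotate
  (class_conj_linearIsometryEquiv exists_linearIsometryEquiv_symm_single_two)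

/-- A linear isometry of `ℝ³` of determinant `−1` fixing `e₃`: the reflection in the plane `{x₀ = 0}`. -/
theorem exists_linearIsometryEquiv_det_neg_one_single_two :
    ∃ N : EuclideanSpace ℝ (Fin 3) ≃ₗᵢ[ℝ] EuclideanSpace ℝ (Fin 3),
      N (EuclideanSpace.single 2 1) = EuclideanSpace.single 2 1 ∧
      (N : EuclideanSpace ℝ (Fin 3) →L[ℝ] EuclideanSpace ℝ (Fin 3)).det = -1 := by
  set e₀ : EuclideanSpace ℝ (Fin 3) := EuclideanSpace.single 0 1 with he₀
  have he₀ne : e₀ ≠ 0 := by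
    intro h
    have := congrArg (fun w : EuclideanSpace ℝ (Fin 3) => w 0) h
    simp [he₀] at this
  set K : Submodule ℝ (EuclideanSpace ℝ (Fin 3)) := (ℝ ∙ e₀)ᗮ with hK
  refine ⟨K.reflection, ?_, ?_⟩
  · -- `e₃ ⊥ e₀`, so `e₃ ∈ K` is fixed
    apply Submodule.reflection_mem_subspace_eq_self
    rw [hK, Submodule.mem_orthogonal_singleton_iff_inner_right]
    simp [he₀, EuclideanSpace.inner_single_left]
  · -- `det = (-1) ^ finrank Kᗮ = (-1) ^ finrank (ℝ ∙ e₀) = -1`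
    have h1 : (K.reflection : EuclideanSpace ℝ (Fin 3) →L[ℝ] EuclideanSpace ℝ (Fin 3)).det =
        LinearMap.det K.reflection.toLinearMap := rfl
    rw [h1, K.det_reflection, hK, Submodule.orthogonal_orthogonal, finrank_span_singleton he₀ne, pow_one]

/-- A linear isometry `L` of `ℝ³` of determinant `+1` with `L⁻¹ e₃ = e/‖e‖`, for `e ≠ 0`. -/
theorem exists_linearIsometryEquiv_det_one_symm_single_two {e : EuclideanSpace ℝ (Fin 3)} (he : e ≠ 0) :
    ∃ L : EuclideanSpace ℝ (Fin 3) ≃ₗᵢ[ℝ] EuclideanSpace ℝ (Fin 3),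
      L.symm (EuclideanSpace.single 2 1) = (‖e‖⁻¹ : ℝ) • e ∧
      (L : EuclideanSpace ℝ (Fin 3) →L[ℝ] EuclideanSpace ℝ (Fin 3)).det = 1 := by
  obtain ⟨L₀, hL₀⟩ := exists_linearIsometryEquiv_symm_single_two he
  rcases det_linearIsometryEquiv_eq_one_or_eq_neg_one L₀ with h | h
  · exact ⟨L₀, hL₀, h⟩
  · obtain ⟨N, hNe, hNdet⟩ := exists_linearIsometryEquiv_det_neg_one_single_two
    refine ⟨L₀.trans N, ?_, ?_⟩
    · rw [LinearIsometryEquiv.symm_trans, LinearIsometryEquiv.trans_apply]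
      have hNs : N.symm (EuclideanSpace.single 2 1) = EuclideanSpace.single 2 1 := by
        have h1 := congrArg N.symm hNe
        rw [LinearIsometryEquiv.symm_apply_apply] at h1
        exact h1.symm
      rw [hNs, hL₀]
    · have hcomp : ((L₀.trans N : EuclideanSpace ℝ (Fin 3) ≃ₗᵢ[ℝ] EuclideanSpace ℝ (Fin 3)) :
          EuclideanSpace ℝ (Fin 3) →L[ℝ] EuclideanSpace ℝ (Fin 3)) =
          (N : EuclideanSpace ℝ (Fin 3) →L[ℝ] EuclideanSpace ℝ (Fin 3)).comp
            (L₀ : EuclideanSpace ℝ (Fin 3) →L[ℝ] EuclideanSpace ℝ (Fin 3)) := by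
        ext x
        rfl
      rw [hcomp]
      show LinearMap.det (((N : EuclideanSpace ℝ (Fin 3) →L[ℝ] EuclideanSpace ℝ (Fin 3)) :
          EuclideanSpace ℝ (Fin 3) →ₗ[ℝ] EuclideanSpace ℝ (Fin 3)).comp
        ((L₀ : EuclideanSpace ℝ (Fin 3) →L[ℝ] EuclideanSpace ℝ (Fin 3)) :
          EuclideanSpace ℝ (Fin 3) →ₗ[ℝ] EuclideanSpace ℝ (Fin 3))) = 1
      rw [LinearMap.det_comp]
      change (N : EuclideanSpace ℝ (Fin 3) →L[ℝ] EuclideanSpace ℝ (Fin 3)).det *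
        (L₀ : EuclideanSpace ℝ (Fin 3) →L[ℝ] EuclideanSpace ℝ (Fin 3)).det = 1
      rw [hNdet, h]; norm_num

/-- **PLUMBING stub `stub_rotate` of the `CirculationCarryingRigidity` skeleton of record** (registered signature
`RotationCovariance`, VERBATIM): the `e₃`-Liouville statement `HemisphereLiouvilleE3` implies the crux
`CirculationCarryingRigidity` in every direction `e ≠ 0` — conjugate by a determinant-one linear isometry `L` with
`L⁻¹e₃ = e/‖e‖`; the class, the sign condition and the strict-positivity witness are transported, and the Liouville
conclusion `⟪curl v', e₃⟫ ≡ 0` contradicts the transported witness. -/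
theorem stub_rotate : RotationCovariance := by
  intro hE3 C v hdecay hcont hmild hdiv e he hnn hpos _hsing
  exfalso
  obtain ⟨L, hL, hdet⟩ := exists_linearIsometryEquiv_det_one_symm_single_two he
  obtain ⟨hrate', hcont', hmild', hdiv'⟩ := class_conj_linearIsometryEquiv L hdecay hcont hmild hdiv
  -- the pseudovector law with `det L = 1`: `⟪curl v'(s)(y), e₃⟫ = ‖e‖⁻¹ ⟪curl v(s)(L⁻¹ y), e⟫`
  have hkey : ∀ s y, ⟪curl (fun z => L (v s (L.symm z))) y, EuclideanSpace.single 2 1⟫_ℝ =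
      ‖e‖⁻¹ * ⟪curl (v s) (L.symm y), e⟫_ℝ := by
    intro s y
    have h := inner_curl_conj_linearIsometryEquiv L (v s) y (L.symm (EuclideanSpace.single 2 1))
    rw [LinearIsometryEquiv.apply_symm_apply, hdet, one_mul, hL, inner_smul_right] at h
    exact h
  have hnn' : ∀ s < 0, ∀ y, 0 ≤ ⟪curl ((fun t x => L (v t (L.symm x))) s) y, e3⟫_ℝ := by
    intro s hs y
    show 0 ≤ ⟪curl (fun z => L (v s (L.symm z))) y, EuclideanSpace.single 2 1⟫_ℝ
    rw [hkey]
    exact mul_nonneg (inv_nonneg.2 (norm_nonneg e)) (hnn s hs (L.symm y))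
  have hzero := hE3 C (fun t x => L (v t (L.symm x))) hrate' hcont' hmild' hdiv' hnn'
  obtain ⟨s₀, hs₀, y₀, hy₀⟩ := hpos
  have h0 : ⟪curl (fun z => L (v s₀ (L.symm z))) (L y₀), EuclideanSpace.single 2 1⟫_ℝ = 0 := hzero s₀ hs₀ (L y₀)
  rw [hkey, LinearIsometryEquiv.symm_apply_apply] at h0
  have hne : ‖e‖⁻¹ * ⟪curl (v s₀) y₀, e⟫_ℝ ≠ 0 :=
    mul_ne_zero (inv_ne_zero (norm_ne_zero_iff.2 he)) hy₀.ne'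
  exact hne h0

end Summit.NavierStokesRegularity.NavierStokesRegularity.Theorems.HalfSpaceWindowDoorCirculationCarryingRigidityRotate

end
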